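import Summits.QuantumFields.BalabanUV.Beta.FP.SliceVertex
import Mathlib.Analysis.SpecialFunctions.Exponential

/-!
# `BalabanUV.Beta.FP.SliceExpChart` — road «FP» for binder row D1, row H2V-2, companion of `FP/SliceVertex` (part 1) ∕ `FP/SliceCubicGerm` (part 2):
# THE EXPONENTIAL CHART — an3's first-order covariant divergence `covDiv₁` and the slice functional `sliceForm₁` ARE the first `t`-jets of the EXACT
# lattice objects built with `exp`: `d/dt|₀ covDivExp e W (t•B) = divTwist`, `d/dt|₀ (−½Σ_x τ((covDivExp e W (t•B))(x)²)) = −divGerm`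

HONEST DEPENDENCY (page 1, mandatory): continuum YM on T⁴ ⇐ BetaPertH ∧ nine spine estimates (0/9 proved); BetaPertH ⇐ (D1) ∧ (D4) ∧ CAP+tail;
G-an2-4 gates asym, D1 and NE2/3/4.  HONEST FRAMING (cell contract, verbatim): «discharging `BetaPertH` makes Bałaban's UV stability UNCONDITIONAL —
a real constructive-QFT result; it is NOT the continuum limit and NOT the Clay problem.»  THIS MODULE DISCHARGES NOTHING of the wall: one-variable calculus in a
complete normed `ℝ`-algebra (Mathlib's `hasDerivAt_exp_smul_const`, product and sum rules), `[folklore]` throughout; two data definitions asserting nothing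
(`covDivExp`, `sliceFormExp`); nothing cited, no `def … : Prop`, no `sorry`.  NOT an estimate, NOT H2-ASM, NOT hgerm, NOT D1, NOT BetaPertH, NOT continuum, NOT Clay.

ABSOLUTE RULE (cell charter, verbatim): «No internally-minted statement may enter as a cited fact. Every hypothesis is either kernel-proved in this package or a
verbatim quotation of a PUBLISHED theorem with page reference. The manuscript(s) under audit are NOT citable for their own disputed steps — they are the thing
under adjudication; programme-internal (2001/route/tribunal) claims are never citable.»  B9 = [Balaban1985BackgroundPropagators] p. 390 «R(U)X = UXU⁻¹» and
p. 392 (3.8) (the covariant adjoint `D*` with `R(U(x, x − e_μ))`) are CONTEXT only.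

WHY.  `PlaquetteWeitzenbock.covDiv₁ = divW + divTwist` carries its first-order status as a LABEL («`R(e^{B_μ(x−e_μ)})⁻¹ = 1 − [B_μ(x−e_μ), ·] + …`; context»).
Here the label becomes a theorem: in the cell's parametrisation `U_b = e^{W_b}e^{B_b}` (so that a fluctuation letter `W_μ(y)` lives at the START `y` of its bond and
the background transporter of the bond `⟨x − e_μ, x⟩` brings it to `x` as `e^{−B}·W·e^{B}` — the orientation for which `covDivExp` transforms by conjugation at `x`
under the local action that leaves the plaquette traces of `WilsonVertex.plaq` invariant), the EXACT covariant backward divergence is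
`covDivExp e W B x := Σ_μ (W_μ(x) − e^{−B_μ(x−e_μ)} W_μ(x−e_μ) e^{B_μ(x−e_μ)})`, and along the ray `t ↦ t•B`:
* `covDivExp_zero : covDivExp e W 0 = divW e W` and **`hasDerivAt_covDivExp : HasDerivAt (t ↦ covDivExp e W (t•B) x) (divTwist e W B x) 0`** — so
  `covDiv₁ e W B = covDivExp e W 0 + d/dt|₀ covDivExp e W (t•B)` (`covDiv₁_eq_jet`): an3's object IS the first jet;
* for a CONTINUOUS tracial `τ`, the exact slice functional `sliceFormExp τ e W B := −½Σ_x τ((covDivExp e W B x)²)` has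
  **`hasDerivAt_sliceFormExp : HasDerivAt (t ↦ sliceFormExp τ e W (t•B)) (−divGerm τ e W B) 0`** — its `B`-linear jet IS the `(2,1)` part `−divGerm` of
  `SliceVertex.sliceForm₁` (`sliceForm₁_eq`), whence (part 1) the slice vertex `(−2)•divVertex` and (part 2) the germ `sliceGerm`; and `sliceFormExp_zero :
  sliceFormExp τ e W 0 = sliceForm₁ τ e W 0` (the two functionals agree at `B = 0`; they differ at second order in `B`, which no cubic vertex sees).
Provenance: G-an2-4 formalisation swarm seat b2b-balaban-gan24-formalise-leaf-02 gen 38 (cross-lane on road FP), 2026-08-21.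
-/

noncomputable section

namespace Summit.QuantumFields.BalabanUV.Beta.FP.SliceExpChart

open Finset
open scoped BigOperators
open NormedSpace (exp)
open Literature.MathematicalPhysics.QuantumFieldTheory.Balaban1983to89.Beta.SpinTable (br)
open Literature.MathematicalPhysics.QuantumFieldTheory.Balaban1983to89.Beta.PlaquetteWeitzenbock (divW divTwist divGerm covDiv₁ br_zero_left)
open Summit.QuantumFields.BalabanUV.Beta.FP.SliceVertex (sliceForm₁)

section Chart

variable {𝔸 : Type*} [NormedRing 𝔸] [NormedAlgebra ℝ 𝔸] [CompleteSpace 𝔸]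
variable {Λ : Type*} [Fintype Λ] [AddCommGroup Λ] {D : Type*} [Fintype D]

/-- [our object] **THE EXACT COVARIANT BACKWARD DIVERGENCE IN THE EXPONENTIAL CHART**:
`covDivExp e W B x = Σ_μ (W_μ(x) − e^{−B_μ(x−e_μ)} · W_μ(x−e_μ) · e^{B_μ(x−e_μ)})` — each incoming fluctuation letter transported to `x` by the inverse background
transporter of its bond (`R(U(x, x−e_μ)) = R(e^{B_μ(x−e_μ)})⁻¹`, B9 (3.8); context).  A definition asserting nothing. -/
def covDivExp (e : D → Λ) (W B : Λ → D → 𝔸) (x : Λ) : 𝔸 :=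
  ∑ μ, (W x μ - exp (-B (x - e μ) μ) * W (x - e μ) μ * exp (B (x - e μ) μ))

omit [NormedAlgebra ℝ 𝔸] [CompleteSpace 𝔸] [Fintype Λ] in
/-- [folklore] at zero background the exact covariant divergence is the plain lattice divergence `divW`. -/
theorem covDivExp_zero (e : D → Λ) (W : Λ → D → 𝔸) (x : Λ) : covDivExp e W 0 x = divW e W x := by
  simp only [covDivExp, divW, Pi.zero_apply, neg_zero, NormedSpace.exp_zero, one_mul, mul_one]

omit [Fintype Λ] [AddCommGroup Λ] [Fintype D] in
/-- [folklore] **THE CONJUGATION PATH**: `t ↦ e^{t(−Y)} · X · e^{tY}` has derivative `−[Y, X]` at `t = 0` (`hasDerivAt_exp_smul_const` twice + the product rule). -/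
theorem hasDerivAt_conj (Y X : 𝔸) : HasDerivAt (fun t : ℝ => exp (t • (-Y)) * X * exp (t • Y)) (-(br Y X)) 0 := by
  have h1 : HasDerivAt (fun t : ℝ => exp (t • (-Y))) (exp ((0 : ℝ) • (-Y)) * (-Y)) 0 := hasDerivAt_exp_smul_const (-Y) 0
  have h2 : HasDerivAt (fun t : ℝ => exp (t • Y)) (exp ((0 : ℝ) • Y) * Y) 0 := hasDerivAt_exp_smul_const Y 0
  rw [zero_smul, NormedSpace.exp_zero, one_mul] at h1 h2
  have h3 := (h1.mul_const X).fun_mul h2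
  simp only [zero_smul, NormedSpace.exp_zero, one_mul, mul_one] at h3
  refine h3.congr_deriv ?_
  rw [br]
  noncomm_ring

omit [Fintype Λ] in
/-- [folklore] **an3's `divTwist` IS THE FIRST JET OF THE EXACT COVARIANT DIVERGENCE**: along the ray `t ↦ t•B`,
`HasDerivAt (t ↦ covDivExp e W (t•B) x) (divTwist e W B x) 0`. -/
theorem hasDerivAt_covDivExp (e : D → Λ) (W B : Λ → D → 𝔸) (x : Λ) :
    HasDerivAt (fun t : ℝ => covDivExp e W (t • B) x) (divTwist e W B x) 0 := by
  have key : (fun t : ℝ => covDivExp e W (t • B) x) =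
      fun t : ℝ => ∑ μ, (W x μ - exp (t • (-B (x - e μ) μ)) * W (x - e μ) μ * exp (t • B (x - e μ) μ)) := by
    funext t
    simp only [covDivExp, Pi.smul_apply, smul_neg]
  rw [key, divTwist]
  refine HasDerivAt.fun_sum fun μ _ => ?_
  have h := (hasDerivAt_const (0 : ℝ) (W x μ)).fun_sub (hasDerivAt_conj (B (x - e μ) μ) (W (x - e μ) μ))
  refine h.congr_deriv ?_
  rw [zero_sub, neg_neg]

omit [Fintype Λ] in
/-- [folklore] **`covDiv₁` IS THE FIRST-ORDER EXPANSION**: `covDiv₁ e W B x = covDivExp e W 0 x + d/dt|₀ covDivExp e W (t•B) x`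
(value `divW` + derivative `divTwist`; `deriv` form of `hasDerivAt_covDivExp`). -/
theorem covDiv₁_eq_jet (e : D → Λ) (W B : Λ → D → 𝔸) (x : Λ) :
    covDiv₁ e W B x = covDivExp e W 0 x + deriv (fun t : ℝ => covDivExp e W (t • B) x) 0 := by
  rw [covDiv₁, covDivExp_zero, (hasDerivAt_covDivExp e W B x).deriv]

/-- [our object] **THE EXACT BACKGROUND-FEYNMAN SLICE FUNCTIONAL** `−½Σ_x τ((covDivExp e W B x)²)` for a continuous linear functional `τ` (the exponential-chart
twin of `SliceVertex.sliceForm₁`).  A definition asserting nothing. -/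
def sliceFormExp (τ : 𝔸 →L[ℝ] ℝ) (e : D → Λ) (W B : Λ → D → 𝔸) : ℝ :=
  -((2 : ℝ)⁻¹ * ∑ x, τ (covDivExp e W B x * covDivExp e W B x))

omit [CompleteSpace 𝔸] in
/-- [folklore] at zero background the exact and the first-order slice functionals coincide (both are `−½Σ_x τ((divW)(x)²)`). -/
theorem sliceFormExp_zero (τ : 𝔸 →L[ℝ] ℝ) (e : D → Λ) (W : Λ → D → 𝔸) :
    sliceFormExp τ e W 0 = sliceForm₁ (τ : 𝔸 →ₗ[ℝ] ℝ) e W 0 := by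
  simp only [sliceFormExp, sliceForm₁, covDivExp_zero, covDiv₁, divTwist, Pi.zero_apply, br_zero_left, Finset.sum_const_zero, add_zero,
    ContinuousLinearMap.coe_coe]

/-- [folklore] **THE `B`-LINEAR JET OF THE EXACT SLICE FUNCTIONAL IS `−divGerm`** (continuous tracial `τ`): along the ray `t ↦ t•B`,
`HasDerivAt (t ↦ sliceFormExp τ e W (t•B)) (−divGerm τ e W B) 0` — exactly the `(2,1)` part of `SliceVertex.sliceForm₁` (`sliceForm₁_eq`), whence the slice vertex
`(−2)•divVertex` of part 1 and the germ `sliceGerm` of part 2. -/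
theorem hasDerivAt_sliceFormExp (τ : 𝔸 →L[ℝ] ℝ) (hτ : ∀ a b : 𝔸, τ (a * b) = τ (b * a)) (e : D → Λ) (W B : Λ → D → 𝔸) :
    HasDerivAt (fun t : ℝ => sliceFormExp τ e W (t • B)) (-divGerm (τ : 𝔸 →ₗ[ℝ] ℝ) e W B) 0 := by
  have hsq : ∀ x, HasDerivAt (fun t : ℝ => τ (covDivExp e W (t • B) x * covDivExp e W (t • B) x))
      (τ (divTwist e W B x * divW e W x + divW e W x * divTwist e W B x)) 0 := by
    intro x
    have h := (hasDerivAt_covDivExp e W B x).fun_mul (hasDerivAt_covDivExp e W B x)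
    rw [zero_smul, covDivExp_zero] at h
    exact τ.hasFDerivAt.comp_hasDerivAt 0 h
  have hsum := HasDerivAt.fun_sum (u := (Finset.univ : Finset Λ)) fun x _ => hsq x
  have h := (hsum.const_mul (2 : ℝ)⁻¹).fun_neg
  refine h.congr_deriv ?_
  rw [divGerm, ContinuousLinearMap.coe_coe, Finset.mul_sum, ← Finset.sum_neg_distrib, ← Finset.sum_neg_distrib]
  refine Finset.sum_congr rfl fun x _ => ?_
  rw [map_add, hτ (divTwist e W B x) (divW e W x)]
  ring

/-- [folklore] the same in `deriv` form, next to the first-order functional's displayed `(2,1)` part: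
`deriv (t ↦ sliceFormExp τ e W (t•B)) 0 = −divGerm τ e W B`. -/
theorem deriv_sliceFormExp (τ : 𝔸 →L[ℝ] ℝ) (hτ : ∀ a b : 𝔸, τ (a * b) = τ (b * a)) (e : D → Λ) (W B : Λ → D → 𝔸) :
    deriv (fun t : ℝ => sliceFormExp τ e W (t • B)) 0 = -divGerm (τ : 𝔸 →ₗ[ℝ] ℝ) e W B :=
  (hasDerivAt_sliceFormExp τ hτ e W B).deriv

end Chart

end Summit.QuantumFields.BalabanUV.Beta.FP.SliceExpChart
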